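import Summits.AnomalousDissipation.AnomalousDissipation.Theses.WindLine

/-!
# Route WindLine — assembly item `Assembly` (stmt-AnomalousDissipation-11424)

Route `AnomalousDissipation/WindLine`, item stmt-AnomalousDissipation-11424 (`Assembly`, rank 1):
the deciding composition of the route,
`WindyGalerkinSteadyZerothLaw → WindySteadyLimit → WindySteadyIsLerayHopf → AnomalousDissipation`.

Proof (pure logic, the same term as the route file's deciding theorem `closes` restricted to the
three hypotheses it actually uses): from the target `WindyGalerkinSteadyZerothLaw` take the force
`f`, the viscosities `ν j → 0⁺` and the constants `E`, `ε > 0`; for each `j` the support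
`WindySteadyLimit` at `ν = ν j` turns the windy Galerkin steady states at infinitely many
resolutions into ONE steady field `u j ∈ L² ∩ H¹`, weakly divergence free, solving the tested
steady equations, with `∫ |u j|² ≤ E`, the energy equation and `ε ≤ ν j ‖∇(u j)‖²`; the support
`WindySteadyIsLerayHopf` makes the constant path `t ↦ u j` a global Leray–Hopf solution from `u j`
with `meanEnergy = ∫ |u j|²` and `meanDissipation = ν j ‖∇(u j)‖²`. These are verbatim the
witnesses `(f, ν, u₀ j := u j, u j := fun _ => u j)` of
`AnomalousDissipation = Literature.Turb.ZerothLaw` (Doering–Foias 2002 §2 bookkeeping).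

Nothing else is used; in particular no estimate uniform in `ν` and no crux of the route.
-/

-- `Summit.<Summit>.<Problem>` is the tree's mandated summit-side namespace (CONVENTIONS §2); for this
-- single-conjunct summit the two coincide, so the duplicate is deliberate.
set_option linter.dupNamespace false

namespace Summit.AnomalousDissipation.AnomalousDissipation.Theorems

open Summit.AnomalousDissipation.AnomalousDissipation.Theses.WindLine

/-- Settles stmt-AnomalousDissipation-11424 (assembly item `Assembly` of route WindLine):
`WindyGalerkinSteadyZerothLaw → WindySteadyLimit → WindySteadyIsLerayHopf → AnomalousDissipation`.
For each `j`, `WindySteadyLimit (ν j)` extracts a steady weak solution `u j` with `∫ |u j|² ≤ E`,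
the energy equation and `ε ≤ ν j ‖∇(u j)‖²`; `WindySteadyIsLerayHopf` books the constant path as a
global Leray–Hopf solution from `u j` with `meanEnergy = ∫ |u j|²`, `meanDissipation = ν j ‖∇(u j)‖²`;
`choose` over `j` gives the witnesses of `Literature.Turb.ZerothLaw`. [folklore] -/
theorem windLineAssembly_proof :
    Summit.AnomalousDissipation.AnomalousDissipation.Theses.WindLine.Assembly := by
  unfold Assembly
  intro hT hL hH
  obtain ⟨f, hf, hdf, hmf, ν, E, ε, hν, hν0, hε, hX⟩ := hT
  -- one steady Leray–Hopf witness per viscosity `ν j`, with its energy and dissipation booked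
  have key : ∀ j, ∃ u : UnitAddTorus (Fin 3) → EuclideanSpace ℝ (Fin 3),
      Literature.Analysis.FluidPDE.Torus.IsGlobalLerayHopf (ν j) (fun _ => f) u (fun _ => u) ∧
        Literature.Analysis.FluidPDE.meanEnergy (fun _ : ℝ => u) ≤ E ∧
        ε ≤ Literature.Analysis.FluidPDE.meanDissipation (ν j) (fun _ : ℝ => u) := by
    intro j
    obtain ⟨u, hu2, hus, hud, hweak, hE, heq, hεu⟩ := hL (ν j) E ε f (hν j) hf hdf hmf (hX j)
    obtain ⟨hLH, hme, hmd⟩ := hH (ν j) f u (hν j) hf hmf hu2 hus hud hweak heq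
    exact ⟨u, hLH, by rw [hme]; exact hE, by rw [hmd]; exact hεu⟩
  choose u hu using key
  exact ⟨f, hf, hdf, hmf, ν, u, fun j _ => u j, hν, hν0, fun j => (hu j).1, ⟨E, fun j => (hu j).2.1⟩,
    ε, hε, fun j => (hu j).2.2⟩

end Summit.AnomalousDissipation.AnomalousDissipation.Theorems
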